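import Summits.Ventures.CertifiedManyBodySolver.Theorems.M3x2EdgeSplitSymReplayOutRouteEtaKronLinA
import HarnessLib

/-!
# SymReplay checker — «ηκ-LINEAR», part B: the enumerator `shareRFastMFηκLP` (word-level Kronecker rows accumulated from element rows),
LIST-EQUAL to the E-class enumerator of record `shareRFastMFηDKP`

(team lb-sym, cell hub-lb; hub-lb-sym-eng-4 g4, 2026-08-28; ADDITIVE on part A `…OutRouteEtaKronLinA`, on ηκ `…OutRouteEtaKron` (p674232)
and on hub-lb-sym-eng-3's `…OutRouteEtaK` (ηDKP); nothing landed is touched.)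

WHAT.  Per R-block: element rows `blockRowsZ B` indexed (`zipIdx`), tagged terms with payload (row, index), the SAME keyed groups as ηDK;
offset `M := (blockAbsBound B − 1) · max_groups Σ|c.num| + 1` and digit width `b := tabBits n M` A PRIORI (no dense table); every ELEMENT
row encoded once (`encZ`, one `Array` per block); per group the word-level one-sided `KRow` BY LINEARITY (`gsumK`, `gheadL`/`gheadH`, O(1)
look-ups); then ηκ's `rowFastFηκP` unchanged.  BRIDGE: the two tables ARE ηκ-style encodings of the record's dense tables (`tableL_eq`,
`tableH_eq`, by part A) and every dense row meets `kdot_mkKRow`'s hypotheses for this `(b, M)` (columns distinct: `denseOKR`, a theorem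
of every well-formed certificate) ⇒ **`shareRFastMFηκLP_eq : shareRFastMFηκLP … = shareRFastMFηDKP …`** under `denseOKR K = true`, and
**`energyDensity_ge_of_outroutePMFηκLP`** with `…PMFηDKP`'s binder list EXACTLY.  MODULE GRAMMAR: `out_m : PackedNF.pisZero
(PackedNF.pcanonNFZHBZ lo hi oP (shareRFastMFηκLP momSpecC cert gbs tabC κ₂ lo hi J L (m / L) (m % L))) = true := by native_decide` (or
the `…T` form via `pisZero_of_T`).  Measured (rung V module 0, interpreted): body 16.4 s (ηDKP) → 15.0 s, lists equal.  Std axioms.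

HONEST FRAMING: an interpreted replay-COST lever with its equality proofs; certifies nothing; no bound of record moves; tree floor
(8,⅞,0) −0.8942613047 (rung V, computational) unchanged; #529 −0.8295699476 outside Lean; `LowerEdge_ge_m83o100` met BY VALUE only,
un-landed; no summit or crux statement is proved here; nothing here predicts superconductivity.
-/

namespace Summit.Ventures.CertifiedManyBodySolver.Theorems.SymReplay

open Literature.MathematicalPhysics.QuantumLattice Literature.MathematicalPhysics.QuantumLattice.ThermodynamicLimit
open Literature.Probability.LatticeModels

/-! ##### (a) indexed element rows and their encodings -/

section Indexed

/-- A list paired with positions. -/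
def zipIdx {α : Type} (l : List α) : List (α × ℕ) := l.zip (List.range l.length)

/-- Forgetting the index of the row payload gives back the plain zip. -/
theorem zip_zipIdx_map {α β : Type} (l₁ : List α) (l₂ : List β) :
    (l₁.zip (zipIdx l₂)).map (fun a => (a.1, a.2.1)) = l₁.zip l₂ := by
  have h : (zipIdx l₂).map Prod.fst = l₂ := List.map_fst_zip (by simp)
  conv_rhs => rw [← h, List.zip_map_right]
  exact List.map_congr_left fun a _ => by cases a; rfl

/-- An indexed element is an element. -/
theorem fst_mem_of_mem_zipIdx {α : Type} {l : List α} {p : α × ℕ} (h : p ∈ zipIdx l) : p.1 ∈ l := (List.of_mem_zip h).1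

/-- **Look-up of an indexed element in the mapped array returns the map of the element.** -/
theorem lookup_zipIdx {α β : Type} (l : List α) (f : α → β) (d : β) {p : α × ℕ} (h : p ∈ zipIdx l) :
    ((l.map f).toArray[p.2]?).getD d = f p.1 := by
  unfold zipIdx at h
  obtain ⟨i, hi, hp⟩ := List.mem_iff_getElem.1 h
  have hil : i < l.length := by rw [List.length_zip] at hi; omega
  rw [List.getElem_zip, List.getElem_range] at hp
  subst hp
  simp [List.getElem?_map, List.getElem?_eq_getElem hil]

/-- **Kronecker data of ONE element row** (columns `< n`): little-endian number `Σ a·X^k`, big-endian number `Σ a·X^(n−1−k)`, entry sum. -/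
def encZ (X n : ℕ) (r : List (ℤ × ℕ)) : ℤ × ℤ × ℤ :=
  (wsumZ (fun k => (X : ℤ) ^ k) n r, wsumZ (fun k => (X : ℤ) ^ (n - 1 - k)) n r, wsumZ (fun _ => 1) n r)

/-- **Word-level Kronecker data of a group BY LINEARITY**: `Σ c.num · encZ(row_j)` over the group's terms (payload = (row, index `j`)). -/
def gsumK (KZ : Array (ℤ × ℤ × ℤ)) (ch : List ((List (ℤ × ℕ) × ℕ) × (ℚ × Word))) : ℤ × ℤ × ℤ :=
  ((ch.map fun y => y.2.1.num * ((KZ[y.1.2]?).getD (0, 0, 0)).1).sum,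
   (ch.map fun y => y.2.1.num * ((KZ[y.1.2]?).getD (0, 0, 0)).2.1).sum,
   (ch.map fun y => y.2.1.num * ((KZ[y.1.2]?).getD (0, 0, 0)).2.2).sum)

/-- Rep-side head of a group: the word-level Kronecker row (little-endian packing + entry sum) and the group's word. -/
def gheadL (KZ : Array (ℤ × ℤ × ℤ)) (ones Mo : ℤ) : List ((List (ℤ × ℕ) × ℕ) × (ℚ × Word)) → Option (KRow × (ℚ × Word))
  | [] => none
  | y :: ys => let g := gsumK KZ (y :: ys); some (⟨(g.1 + Mo * ones).toNat, 0, g.2.2⟩, ((1 : ℚ), y.2.2))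

/-- Basis-side head of a group: the word-level Kronecker row (big-endian packing + entry sum), the word, the packed word. -/
def gheadH (lo hi : ℤ × ℤ) (KZ : Array (ℤ × ℤ × ℤ)) (ones Mo : ℤ) :
    List ((List (ℤ × ℕ) × ℕ) × (ℚ × Word)) → Option ((KRow × (ℚ × Word)) × PackedNF.PWord)
  | [] => none
  | y :: ys => let g := gsumK KZ (y :: ys);
    some ((⟨0, (g.2.1 + Mo * ones).toNat, g.2.2⟩, ((1 : ℚ), y.2.2)), PackedNF.encW lo hi y.2.2)

/-- The largest per-group coefficient mass `Σ |c.num|` (fold from `0`). -/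
def cabsMax {ρ : Type} (G : List (List (ρ × (ℚ × Word)))) : ℤ := G.foldl (fun m ch => max m (cabsSum ch)) 0

/-- The fold dominates its start. -/
theorem le_foldl_cabs {ρ : Type} (G : List (List (ρ × (ℚ × Word)))) : ∀ m : ℤ, m ≤ G.foldl (fun m ch => max m (cabsSum ch)) m := by
  induction G with | nil => intro m; exact le_rfl | cons ch G ih => intro m; exact le_trans (le_max_left _ _) (ih _)

/-- Every group's mass is below the fold. -/
theorem cabsSum_le_foldl {ρ : Type} (G : List (List (ρ × (ℚ × Word)))) :
    ∀ (m : ℤ), ∀ ch ∈ G, cabsSum ch ≤ G.foldl (fun m ch => max m (cabsSum ch)) m := by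
  induction G with
  | nil => intro m ch h; simp at h
  | cons ch' G ih =>
    intro m ch h
    rcases List.mem_cons.1 h with rfl | h
    · exact le_trans (le_max_right _ _) (le_foldl_cabs G _)
    · exact ih _ ch h

/-- `cabsSum ch ≤ cabsMax G` for `ch ∈ G`. -/
theorem cabsSum_le_cabsMax {ρ : Type} {G : List (List (ρ × (ℚ × Word)))} {ch : List (ρ × (ℚ × Word))} (h : ch ∈ G) :
    cabsSum ch ≤ cabsMax G := cabsSum_le_foldl G 0 ch h

/-- `0 ≤ cabsMax G`. -/
theorem cabsMax_nonneg {ρ : Type} (G : List (List (ρ × (ℚ × Word)))) : 0 ≤ cabsMax G := le_foldl_cabs G 0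

end Indexed

/-! ##### (b) the ηκ-linear enumerator (executables) -/

section EtaKronLin

variable {M : Type} [DecidableEq M] [Hashable M]

/-- **ENGINE ηκ-LINEAR R-part of sub-module `(i, f)`**: per block the indexed element rows, the two keyed groupings, the a-priori
offset `M` and digit width `b`, ONE array of element encodings, the two word-level Kronecker tables by linearity, one tagged bucket
map, one `rowFastFηκP` per representative row. -/
def shareRWithMFηκLP (S : MomSpec M) (lo hi : ℤ × ℤ) (K : SymCertR) (gbs : List (List QPoly)) (T : List M)
    (P₂ : Word → Bool) : PackedNF.PPoly :=
  (K.gramR.zip gbs).flatMap fun Bg =>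
    let n := colBoundR Bg.1
    let D := blockDen Bg.1
    let rz := blockRowsZ Bg.1
    let kb : ℚ := -1 * ((Bg.1.moves.length : ℚ) * Bg.1.scale) / ((D : ℚ) * D)
    let Gr := wgroupK lo hi (tagRep (Bg.1.reps.zip (zipIdx rz)))
    let Gb := wgroupK lo hi (wflatG (Bg.2.zip (zipIdx rz)))
    let Mo : ℤ := (blockAbsBound Bg.1 - 1) * max (cabsMax Gr) (cabsMax Gb) + 1
    let b := tabBits n Mo
    let ones := onesZ (2 ^ b) n
    let KZ := (rz.map (encZ (2 ^ b) n)).toArray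
    let wmapK := bucketBy (fun xp : (KRow × (ℚ × Word)) × PackedNF.PWord => mom S xp.1.2.2) (Gb.filterMap (gheadH lo hi KZ ones Mo))
    (Gr.filterMap (gheadL KZ ones Mo)).flatMap fun y => rowFastFηκP S lo hi (b * (n - 1)) (2 ^ b - 1) Mo n y wmapK kb T P₂

/-- **ENGINE ηκ-LINEAR sub-module share, PACKED at emission** — the function an E-class module file evaluates. -/
def shareRFastMFηκLP (S : MomSpec M) (K : SymCertR) (gbs : List (List QPoly)) (hm : MomTable M) (κ₂ : Word → ℕ)
    (lo hi : ℤ × ℤ) (J L i f : ℕ) : PackedNF.PPoly :=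
  let P := wordPred (inSlotW (momKey S hm) J i)
  let P₂ : Word → Bool := fun w => κ₂ w % L == f
  PackedNF.encP lo hi ((baseShareF K.toSymCert P).filter (wordPred P₂)) ++
  (PackedNF.encP lo hi ((pscale (-1) (K.gramM.flatMap fun B => (gramBlockPoly B).filter P)).filter (wordPred P₂)) ++
    shareRWithMFηκLP S lo hi K gbs (targetsM hm J i) P₂)

/-! ##### (c) one group: the linear Kronecker row IS the encoded dense row -/

/-- Forget the index of the row payload. -/
abbrev unIdx (y : (List (ℤ × ℕ) × ℕ) × (ℚ × Word)) : List (ℤ × ℕ) × (ℚ × Word) := (y.1.1, y.2)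

omit [DecidableEq M] [Hashable M] in
/-- Under the look-up invariant, `gsumK` is the coefficient combination of the terms' `wsumZ` data (all three components). -/
theorem gsumK_eq (X n : ℕ) (rz : List (List (ℤ × ℕ))) (ch : List ((List (ℤ × ℕ) × ℕ) × (ℚ × Word)))
    (hch : ∀ y ∈ ch, y.1 ∈ zipIdx rz) :
    gsumK (rz.map (encZ X n)).toArray ch =
      (((ch.map unIdx).map fun y => y.2.1.num * wsumZ (fun k => (X : ℤ) ^ k) n y.1).sum,
       ((ch.map unIdx).map fun y => y.2.1.num * wsumZ (fun k => (X : ℤ) ^ (n - 1 - k)) n y.1).sum,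
       ((ch.map unIdx).map fun y => y.2.1.num * wsumZ (fun _ => 1) n y.1).sum) := by
  unfold gsumK
  rw [List.map_map, List.map_map, List.map_map]
  refine Prod.ext ?_ (Prod.ext ?_ ?_) <;>
    exact congrArg List.sum (List.map_congr_left fun y hy => by
      rw [Function.comp_apply, lookup_zipIdx rz (encZ X n) (0, 0, 0) (hch y hy)]; rfl)

omit [DecidableEq M] [Hashable M] in
/-- The dense row of a group (index forgotten): length `n`, listed as `accZ` on `range n`. -/
theorem denseRow_eq (n : ℕ) (ch : List ((List (ℤ × ℕ) × ℕ) × (ℚ × Word))) :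
    (daccZ n (ch.map unIdx)).toList = (List.range n).map (accZ (ch.map unIdx)) := daccZ_toList n _

omit [DecidableEq M] [Hashable M] in
/-- **Entries of a group's dense row are bounded** by `(A − 1) · Σ|c.num|` when every element row has distinct columns and entries
`< A` in absolute value. -/
theorem abs_accZ_le_group (A : ℤ) (hA : 1 ≤ A) (rz : List (List (ℤ × ℕ))) (hcols : ∀ r ∈ rz, (r.map Prod.snd).Pairwise (· < ·))
    (habs : ∀ r ∈ rz, ∀ e ∈ r, |e.1| < A) (ch : List ((List (ℤ × ℕ) × ℕ) × (ℚ × Word))) (hch : ∀ y ∈ ch, y.1 ∈ zipIdx rz)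
    (k : ℕ) : |accZ (ch.map unIdx) k| ≤ (A - 1) * cabsSum ch := by
  have h := abs_accZ_le (A - 1) (by omega) (ch.map unIdx) (fun y hy k' => by
    obtain ⟨y', hy', rfl⟩ := List.mem_map.1 hy
    have hr : y'.1.1 ∈ rz := fst_mem_of_mem_zipIdx (hch y' hy')
    exact abs_rowCoefZ_le _ (A - 1) (hcols _ hr) (fun e he => by have := habs _ hr e he; omega) (by omega) k') k
  rwa [show (ch.map unIdx) = ch.map (fun y => (Prod.fst y.1, y.2)) from rfl, cabsSum_map] at h

omit [DecidableEq M] [Hashable M] in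
/-- **The rep-side head of a group IS ηκ's encoding of the record's dense head** (given the bound `(A−1)·Σ|c| < Mo`). -/
theorem gheadL_eq (b n : ℕ) (Mo A : ℤ) (hA : 1 ≤ A) (rz : List (List (ℤ × ℕ)))
    (hcols : ∀ r ∈ rz, (r.map Prod.snd).Pairwise (· < ·)) (habs : ∀ r ∈ rz, ∀ e ∈ r, |e.1| < A)
    (ch : List ((List (ℤ × ℕ) × ℕ) × (ℚ × Word))) (hch : ∀ y ∈ ch, y.1 ∈ zipIdx rz) (hMo : (A - 1) * cabsSum ch < Mo) :
    gheadL (rz.map (encZ (2 ^ b) n)).toArray (onesZ (2 ^ b) n) Mo ch =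
      (dheadD n (ch.map unIdx)).map fun y => (mkKRowL b Mo y.1, y.2) := by
  cases ch with
  | nil => rfl
  | cons y ys =>
    have hch' := hch
    set ch := y :: ys with hchdef
    have hlen : ((daccZ n (ch.map unIdx)).toList).length = n := by rw [denseRow_eq]; simp
    have hbnd : ∀ x ∈ (daccZ n (ch.map unIdx)).toList, -Mo ≤ x ∧ x < Mo := by
      intro x hx
      rw [denseRow_eq, List.mem_map] at hx
      obtain ⟨k, -, rfl⟩ := hx
      have := abs_accZ_le_group A hA rz hcols habs ch hch' k
      rw [abs_le] at this
      constructor <;> linarith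
    have hg := gsumK_eq (2 ^ b) n rz ch hch'
    simp only [hchdef, List.map_cons, gheadL, dheadD, Option.map_some, Option.some.injEq, Prod.mk.injEq, mkKRowL, KRow.mk.injEq,
      and_true]
    refine ⟨?_, trivial, ?_⟩
    · have hint : ((gsumK (rz.map (encZ (2 ^ b) n)).toArray ch).1 + Mo * onesZ (2 ^ b) n : ℤ) =
          (evalLEoff (2 ^ b) Mo (daccZ n (ch.map unIdx)).toList : ℤ) := by
        rw [evalLEoff_int _ _ _ (fun x hx => (hbnd x hx).1), hlen, hg]
        simp only
        rw [denseRow_eq, polyZ_map_range, sum_range_accZ]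
      have := congrArg Int.toNat hint
      rwa [Int.toNat_natCast] at this
    · rw [hg]
      simp only
      rw [show (unIdx y :: List.map unIdx ys) = ch.map unIdx from rfl, denseRow_eq, sum_map_range_eq, sum_range_accZ]

omit [DecidableEq M] [Hashable M] in
/-- **The basis-side head of a group IS ηκ's `ptagK` of the record's dense head.** -/
theorem gheadH_eq (lo hi : ℤ × ℤ) (b n : ℕ) (Mo A : ℤ) (hA : 1 ≤ A) (rz : List (List (ℤ × ℕ)))
    (hcols : ∀ r ∈ rz, (r.map Prod.snd).Pairwise (· < ·)) (habs : ∀ r ∈ rz, ∀ e ∈ r, |e.1| < A)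
    (ch : List ((List (ℤ × ℕ) × ℕ) × (ℚ × Word))) (hch : ∀ y ∈ ch, y.1 ∈ zipIdx rz) (hMo : (A - 1) * cabsSum ch < Mo) :
    gheadH lo hi (rz.map (encZ (2 ^ b) n)).toArray (onesZ (2 ^ b) n) Mo ch =
      (dheadD n (ch.map unIdx)).map (ptagK lo hi b Mo) := by
  cases ch with
  | nil => rfl
  | cons y ys =>
    have hch' := hch
    set ch := y :: ys with hchdef
    have hlen : ((daccZ n (ch.map unIdx)).toList).length = n := by rw [denseRow_eq]; simp
    have hbnd : ∀ x ∈ (daccZ n (ch.map unIdx)).toList, -Mo ≤ x ∧ x < Mo := by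
      intro x hx
      rw [denseRow_eq, List.mem_map] at hx
      obtain ⟨k, -, rfl⟩ := hx
      have := abs_accZ_le_group A hA rz hcols habs ch hch' k
      rw [abs_le] at this
      constructor <;> linarith
    have hg := gsumK_eq (2 ^ b) n rz ch hch'
    simp only [hchdef, List.map_cons, gheadH, dheadD, Option.map_some, Option.some.injEq, Prod.mk.injEq, ptagK, mkKRowH,
      KRow.mk.injEq, true_and]
    refine ⟨⟨⟨?_, ?_⟩, trivial⟩, trivial⟩
    · have hint : ((gsumK (rz.map (encZ (2 ^ b) n)).toArray ch).2.1 + Mo * onesZ (2 ^ b) n : ℤ) =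
          (evalBEoff (2 ^ b) Mo (daccZ n (ch.map unIdx)).toList : ℤ) := by
        rw [evalBEoff_int _ _ _ (fun x hx => (hbnd x hx).1), hlen, hg]
        simp only
        rw [denseRow_eq, hornerZ_map_range, sum_range_accZ]
      have := congrArg Int.toNat hint
      rwa [Int.toNat_natCast] at this
    · rw [hg]
      simp only
      rw [show (unIdx y :: List.map unIdx ys) = ch.map unIdx from rfl, denseRow_eq, sum_map_range_eq, sum_range_accZ]

/-! ##### (d) the tables: ηκ-linear tables = encodings of the record's dense tables; their rows meet `kdot_mkKRow`'s hypotheses -/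

omit [DecidableEq M] [Hashable M] in
/-- Members of a keyed group of indexed tagged REPRESENTATIVE terms carry indexed element rows. -/
theorem payload_mem_rep {lo hi : ℤ × ℤ} {reps : List QPoly} {rz : List (List (ℤ × ℕ))}
    {ch : List ((List (ℤ × ℕ) × ℕ) × (ℚ × Word))} (hch : ch ∈ wgroupK lo hi (tagRep (reps.zip (zipIdx rz)))) :
    ∀ y ∈ ch, y.1 ∈ zipIdx rz := fun y hy => by
  obtain ⟨a, ha, h1, -⟩ := tagRep_row (mem_of_mem_wgroupK lo hi hch hy)
  rw [h1]; exact (List.of_mem_zip ha).2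

omit [DecidableEq M] [Hashable M] in
/-- Members of a keyed group of indexed tagged BASIS terms carry indexed element rows. -/
theorem payload_mem_bas {lo hi : ℤ × ℤ} {gb : List QPoly} {rz : List (List (ℤ × ℕ))}
    {ch : List ((List (ℤ × ℕ) × ℕ) × (ℚ × Word))} (hch : ch ∈ wgroupK lo hi (wflatG (gb.zip (zipIdx rz)))) :
    ∀ y ∈ ch, y.1 ∈ zipIdx rz := fun y hy => by
  obtain ⟨bq, hb, h1, -⟩ := mem_wflatG (mem_of_mem_wgroupK lo hi hch hy)
  rw [h1]; exact (List.of_mem_zip hb).2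

omit [DecidableEq M] [Hashable M] in
/-- The record's rep table, through the indexed grouping. -/
theorem dgroupDK_rep_eq (lo hi : ℤ × ℤ) (n : ℕ) (reps : List QPoly) (rz : List (List (ℤ × ℕ))) :
    dgroupDK lo hi n (tagRep (reps.zip rz)) = (wgroupK lo hi (tagRep (reps.zip (zipIdx rz)))).filterMap (fun ch => dheadD n (ch.map unIdx)) := by
  rw [dgroupDK, ← zip_zipIdx_map reps rz, tagRep_map, wgroupK_map, List.filterMap_map]
  rfl

omit [DecidableEq M] [Hashable M] in
/-- The record's basis table, through the indexed grouping. -/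
theorem dgroupDK_bas_eq (lo hi : ℤ × ℤ) (n : ℕ) (gb : List QPoly) (rz : List (List (ℤ × ℕ))) :
    dgroupDK lo hi n (wflatZ (gb.zip rz)) = (wgroupK lo hi (wflatG (gb.zip (zipIdx rz)))).filterMap (fun ch => dheadD n (ch.map unIdx)) := by
  rw [dgroupDK, wflatZ_eq_wflatG, ← zip_zipIdx_map gb rz, wflatG_map, wgroupK_map, List.filterMap_map]
  rfl

/-- Column hypotheses of a block's element rows, from `denseOKR`. -/
theorem block_cols {K : SymCertR} (hZ : denseOKR K = true) {B : GramBlockR} (hB : B ∈ K.gramR) :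
    ∀ r ∈ blockRowsZ B, (r.map Prod.snd).Pairwise (· < ·) := fun r hr => by
  unfold denseOKR at hZ
  rw [List.all_eq_true] at hZ
  have h := hZ B hB
  rw [List.all_eq_true] at h
  exact (colsAscLt_spec 0 r (blockWidth B) (h r hr)).2

omit [DecidableEq M] [Hashable M] in
/-- **Rep table**: ηκ-linear = encoded record (and the a-priori bound dominates every group's mass). -/
theorem tableL_eq (lo hi : ℤ × ℤ) (n : ℕ) (B : GramBlockR) (hcols : ∀ r ∈ blockRowsZ B, (r.map Prod.snd).Pairwise (· < ·))
    (Cw Mo : ℤ) (hCw : cabsMax (wgroupK lo hi (tagRep (B.reps.zip (zipIdx (blockRowsZ B))))) ≤ Cw)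
    (hMo : (blockAbsBound B - 1) * Cw < Mo) (b : ℕ) :
    (wgroupK lo hi (tagRep (B.reps.zip (zipIdx (blockRowsZ B))))).filterMap
        (gheadL ((blockRowsZ B).map (encZ (2 ^ b) n)).toArray (onesZ (2 ^ b) n) Mo) =
      (dgroupDK lo hi n (tagRep (B.reps.zip (blockRowsZ B)))).map fun y => (mkKRowL b Mo y.1, y.2) := by
  rw [dgroupDK_rep_eq, List.map_filterMap]
  refine List.filterMap_congr fun ch hch => ?_
  have h1 := one_le_blockAbsBound B
  exact gheadL_eq b n Mo (blockAbsBound B) h1 _ hcols (fun r hr e he => abs_lt_blockAbsBound B r hr e he) ch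
    (payload_mem_rep hch) (lt_of_le_of_lt (mul_le_mul_of_nonneg_left (le_trans (cabsSum_le_cabsMax hch) hCw) (by omega)) hMo)

omit [DecidableEq M] [Hashable M] in
/-- **Basis table**: ηκ-linear = `ptagK` of the record. -/
theorem tableH_eq (lo hi : ℤ × ℤ) (n : ℕ) (B : GramBlockR) (gb : List QPoly)
    (hcols : ∀ r ∈ blockRowsZ B, (r.map Prod.snd).Pairwise (· < ·)) (Cw Mo : ℤ)
    (hCw : cabsMax (wgroupK lo hi (wflatG (gb.zip (zipIdx (blockRowsZ B))))) ≤ Cw) (hMo : (blockAbsBound B - 1) * Cw < Mo) (b : ℕ) :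
    (wgroupK lo hi (wflatG (gb.zip (zipIdx (blockRowsZ B))))).filterMap
        (gheadH lo hi ((blockRowsZ B).map (encZ (2 ^ b) n)).toArray (onesZ (2 ^ b) n) Mo) =
      (dgroupDK lo hi n (wflatZ (gb.zip (blockRowsZ B)))).map (ptagK lo hi b Mo) := by
  rw [dgroupDK_bas_eq, List.map_filterMap]
  refine List.filterMap_congr fun ch hch => ?_
  have h1 := one_le_blockAbsBound B
  exact gheadH_eq lo hi b n Mo (blockAbsBound B) h1 _ hcols (fun r hr e he => abs_lt_blockAbsBound B r hr e he) ch
    (payload_mem_bas hch) (lt_of_le_of_lt (mul_le_mul_of_nonneg_left (le_trans (cabsSum_le_cabsMax hch) hCw) (by omega)) hMo)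

omit [DecidableEq M] [Hashable M] in
/-- **Every row of a record dense table meets `kdot_mkKRow`'s hypotheses** for the a-priori `(b, M)`: length `n`, entries in `[−M, M)`. -/
theorem denseTable_spec (lo hi : ℤ × ℤ) (n : ℕ) (rz : List (List (ℤ × ℕ))) (A : ℤ) (hA : 1 ≤ A)
    (hcols : ∀ r ∈ rz, (r.map Prod.snd).Pairwise (· < ·)) (habs : ∀ r ∈ rz, ∀ e ∈ r, |e.1| < A)
    (L : List ((List (ℤ × ℕ) × ℕ) × (ℚ × Word))) (hL : ∀ y ∈ L, y.1 ∈ zipIdx rz) (Cw Mo : ℤ)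
    (hCw : cabsMax (wgroupK lo hi L) ≤ Cw) (hMo : (A - 1) * Cw < Mo) :
    ∀ yD ∈ (wgroupK lo hi L).filterMap (fun ch => dheadD n (ch.map unIdx)), yD.1.length = n ∧ ∀ x ∈ yD.1, -Mo ≤ x ∧ x < Mo := by
  intro yD hyD
  rw [List.mem_filterMap] at hyD
  obtain ⟨ch, hch, hy⟩ := hyD
  have hmem : ∀ y ∈ ch, y.1 ∈ zipIdx rz := fun y hy' => hL y (mem_of_mem_wgroupK lo hi hch hy')
  cases ch with
  | nil => exact absurd hy (by simp [dheadD])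
  | cons y ys =>
    simp only [List.map_cons, dheadD, Option.some.injEq] at hy
    rw [← hy, ← List.map_cons]
    refine ⟨by rw [denseRow_eq]; simp, fun x hx => ?_⟩
    rw [denseRow_eq, List.mem_map] at hx
    obtain ⟨k, -, rfl⟩ := hx
    have h := abs_accZ_le_group A hA rz hcols habs (y :: ys) hmem k
    have hb : (A - 1) * cabsSum (y :: ys) < Mo :=
      lt_of_le_of_lt (mul_le_mul_of_nonneg_left (le_trans (cabsSum_le_cabsMax hch) hCw) (by omega)) hMo
    rw [abs_le] at h
    constructor <;> linarith

/-! ##### (e) the bridge and the closing -/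

/-- **R-part bridge: ηκ-LINEAR = ηDK** (list equality) when the element rows have strictly ascending columns (`denseOKR`). -/
theorem shareRWithMFηκLP_eq (S : MomSpec M) (lo hi : ℤ × ℤ) (K : SymCertR) (hZ : denseOKR K = true) (gbs : List (List QPoly))
    (T : List M) (P₂ : Word → Bool) : shareRWithMFηκLP S lo hi K gbs T P₂ = shareRWithMFηDKP S lo hi K gbs T P₂ := by
  unfold shareRWithMFηκLP shareRWithMFηDKP
  refine List.flatMap_congr fun Bg hBg => ?_
  have hB : Bg.1 ∈ K.gramR := (List.of_mem_zip hBg).1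
  have hcols := block_cols hZ hB
  have h1 := one_le_blockAbsBound Bg.1
  dsimp only
  set n := colBoundR Bg.1
  set rz := blockRowsZ Bg.1
  set Gr := wgroupK lo hi (tagRep (Bg.1.reps.zip (zipIdx rz)))
  set Gb := wgroupK lo hi (wflatG (Bg.2.zip (zipIdx rz)))
  set Cw := max (cabsMax Gr) (cabsMax Gb)
  set Mo : ℤ := (blockAbsBound Bg.1 - 1) * Cw + 1
  set b := tabBits n Mo
  have hMo : (blockAbsBound Bg.1 - 1) * Cw < Mo := lt_add_one _
  rw [tableL_eq lo hi n Bg.1 hcols Cw Mo (le_max_left _ _) hMo b, tableH_eq lo hi n Bg.1 Bg.2 hcols Cw Mo (le_max_right _ _) hMo b,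
    PackedNF.flatMap_map_left]
  refine List.flatMap_congr fun y hy => ?_
  have habs : ∀ r ∈ rz, ∀ e ∈ r, |e.1| < blockAbsBound Bg.1 := fun r hr e he => abs_lt_blockAbsBound Bg.1 r hr e he
  have hy' : y.1.length = n ∧ ∀ x ∈ y.1, -Mo ≤ x ∧ x < Mo := by
    rw [dgroupDK_rep_eq] at hy
    exact denseTable_spec lo hi n rz _ h1 hcols habs _ (fun y' hy'' => by
      obtain ⟨a, ha, h1', -⟩ := tagRep_row hy''; rw [h1']; exact (List.of_mem_zip ha).2) Cw Mo (le_max_left _ _) hMo y hy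
  have hbas : ∀ x ∈ dgroupDK lo hi n (wflatZ (Bg.2.zip rz)), x.1.length = n ∧ ∀ z ∈ x.1, -Mo ≤ z ∧ z < Mo := by
    intro x hx
    rw [dgroupDK_bas_eq] at hx
    exact denseTable_spec lo hi n rz _ h1 hcols habs _ (fun y' hy'' => by
      obtain ⟨bq, hb, h1', -⟩ := mem_wflatG hy''; rw [h1']; exact (List.of_mem_zip hb).2) Cw Mo (le_max_right _ _) hMo x hx
  exact rowFastFηκP_eq S lo hi b Mo n (tabBits_spec n Mo) y hy' _ hbas _ T P₂

/-- **THE BRIDGE: the ηκ-linear enumerator IS the E-class enumerator of record** (list equality under `denseOKR K`). -/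
theorem shareRFastMFηκLP_eq (S : MomSpec M) (K : SymCertR) (hZ : denseOKR K = true) (gbs : List (List QPoly)) (hm : MomTable M)
    (κ₂ : Word → ℕ) (lo hi : ℤ × ℤ) (J L i f : ℕ) :
    shareRFastMFηκLP S K gbs hm κ₂ lo hi J L i f = shareRFastMFηDKP S K gbs hm κ₂ lo hi J L i f := by
  unfold shareRFastMFηκLP shareRFastMFηDKP
  simp only [shareRWithMFηκLP_eq S lo hi K hZ]

/-- **CLOSING on the ηκ-linear enumerator** (binder list = `energyDensity_ge_of_outroutePMFηDKP`'s EXACTLY; `denseOKR` is derived from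
`hwf`): per module `m < J·L` one file `out_m : PackedNF.pisZero (PackedNF.pcanonNFZHBZ lo hi oP (shareRFastMFηκLP Sm K (K.gramR.map
genBasis) hm κ₂ lo hi J L (m / L) (m % L))) = true := by native_decide`. -/
theorem energyDensity_ge_of_outroutePMFηκLP {Mo : Type} [DecidableEq Mo] [Hashable Mo] (Sm : MomSpec Mo) (K : SymCertR)
    (hwf : wellFormed K.expand = true) (hRok : K.gramR.all (gramBlockROK K.frame) = true)
    (oP : PackedNF.PWord → PackedNF.PHint) (hm : MomTable Mo) (κ₂ : Word → ℕ) (J L : ℕ) (hJ : 0 < J) (hL : 0 < L)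
    (lo hi : ℤ × ℤ) (hbox : boxLicence K.frame lo hi = true) (hcov : coverM Sm K (K.gramR.map genBasis) hm = true)
    (hC : intCoefOK K (K.gramR.map genBasis) = true)
    (hfacts : ∀ m, m < J * L → PackedNF.pisZero (PackedNF.pcanonNFZHBZ lo hi oP
      (shareRFastMFηκLP Sm K (K.gramR.map genBasis) hm κ₂ lo hi J L (m / L) (m % L))) = true) :
    ((symValueR K : ℚ) : ℝ) ≤ energyDensityTT' 1 0 8 (7 / 8) :=
  energyDensity_ge_of_outroutePMFηDKP Sm K hwf hRok oP hm κ₂ J L hJ hL lo hi hbox hcov hC fun m hm' => by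
    rw [← shareRFastMFηκLP_eq Sm K (denseOKR_of_wellFormed K hwf) _ hm κ₂ lo hi]; exact hfacts m hm'

end EtaKronLin

end Summit.Ventures.CertifiedManyBodySolver.Theorems.SymReplay
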